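import Mathlib
import Summits.AtomisticToContinuum.HydrodynamicLimit.Theorems.InformationPercolationEngineKickFairRelEquilibriumMesoConditionThePastDefs
import Summits.AtomisticToContinuum.HydrodynamicLimit.Theorems.InformationPercolationEngineKickFairRelEquilibriumMesoTransferEnum
import HarnessLib

/-!
# `KickFairRelEquilibriumMeso`, line `condition-the-past` — the PATHWISE count behind CT-b
# (`UnorderedPairWeight`): at most `8 (N+1) Σ_i cnt_i` unordered pairs of kick records on the good set

Prover file (`--supports stmt-AtomisticToContinuum-15177`) of the checked skeleton
`Cruxes/KickFairRelEquilibriumMeso/Lines/condition_the_past.lean` (rev 2, lead c7), stub CT-b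
`stub_unorderedPairWeight : UnorderedPairWeight rs` (`…MesoConditionThePastDefs`). CT-b asks that the
`(ε/(N+1))²`-weighted number of UNORDERED pairs of counted kick records — pairs `((i,n),(i',n'))`, `n < cnt_i`,
`n' < cnt_{i'}`, with neither `Precedes P_{i,n} P_{i',n'}` nor `Precedes P_{i',n'} P_{i,n}`, where
`Precedes p p' := t(p) < flightStart_{i'}(p') ∧ t(p) < flightStart_{partner}(p')` — be small in `LG`-mean. This
file proves the law-independent combinatorial heart, `unorderedPairCount_le`: on the good set, for every mesh `r`,

  `#{unordered pairs} ≤ 8 (N+1) · Σ_i cnt_i`.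

Proof. If neither record precedes the other and `t_{i,n} ≤ t_{i',n'}`, then `¬ Precedes P_{i,n} P_{i',n'}` says
`t_{i,n} ≥ flightStart_{i'}(t_{i',n'})` or `t_{i,n} ≥ flightStart_{q'}(t_{i',n'})`, `q'` the partner of `i'`: the
earlier collision happens DURING the flight of `i'` or of `q'` that ends in the later one (the case
`t_{i',n'} ≤ t_{i,n}` is symmetric, `Finset.sum_comm`). Now fix the earlier record and count the later ones:
(own flight) for a fixed sphere `j`, at most TWO positive collision times `s` of `j` satisfy
`flightStart_j(s) ≤ x ≤ s` (`card_filter_flightStart_le_le_two`: past the least such `s`, two more `a < b` would give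
`x < a ≤ flightStart_j(b) ≤ x`, `le_flightStart_of_mem`), and the enumeration `n' ↦ t_{j,n'}` is injective below
`cnt_j` (`strictMonoOn_nthTimeAfter_of_ncard`) — so `≤ 2 (N+1)` records over all `i'`
(`sum_range_cnt_ownFlight_le_two`); (partner's flight) the map `(i',n') ↦ (q', t_{i',n'})` is injective on counted
records — collisions are binary on a hard-sphere trajectory (`IsHardSphereTrajectory.participates_iff`,
`eq_of_collide_of_collide`) and the enumeration is injective — into the pairs `(j, s)`, `s` a collision time of `j`
in `(0, τ]` with `flightStart_j(s) ≤ x ≤ s`, at most two per `j`: again `≤ 2 (N+1)` (`sum_cnt_partnerFlight_le`).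
Summing over the `Σ_i cnt_i` earlier records and doubling for the symmetric case gives `8 (N+1) Σ_i cnt_i`.

Consequence (sequel file `…MesoUnorderedPairWeight`): `(ε/(N+1))² #{unordered} ≤ 8 ε · (ε/(N+1)) Σ_i cnt_i`, so
CT-b follows from ANY `LG`-mean bound `o(ε_N⁻¹)` on the normalised collision count — in particular from CT-a
(`CountExcessLG`, the neighbour stub; open for general profiles) and, at rung 0, from the landed
`countExcessLG_const`. CT-b is therefore NOT a second-moment statement: it carries no content beyond CT-a.
-/

noncomputable section

open MeasureTheory Set Filter Topology
open scoped ENNReal Classical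

namespace Summit.AtomisticToContinuum.HydrodynamicLimit.Theorems.KickFairRelEquilibriumMesoLine

open Literature.Analysis.FluidPDE Literature.MathematicalPhysics.KineticTheory

variable {σ : ℝ} {N : ℕ}

/-! ## At most two flights of one sphere contain a given instant -/

/-- **At most two flights of a sphere contain a given instant.** On the good set, among any finite set `F` of
positive collision times `s` of sphere `j`, at most two satisfy `flightStart_j(s) ≤ x ≤ s`: if `m` is the least
such time, any two further ones `a < b` would give `x ≤ m < a ≤ flightStart_j(b) ≤ x` (`a` is a collision of `j`
in `(0, b)`, `le_flightStart_of_mem`). [folklore] -/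
theorem card_filter_flightStart_le_le_two (Φ : Flow σ N) {z : Phase N} (hz : z ∈ Φ.good) (j : Fin (N + 1))
    (x : ℝ) (F : Finset ℝ)
    (hF : ∀ s ∈ F, s ∈ collisionTimesOf (Torus.geometry (Fin 3)) (hsDiameter σ N) (fun t => Φ.flow t z) j ∧ 0 < s) :
    (F.filter fun s => flightStart (Torus.geometry (Fin 3)) (hsDiameter σ N) (fun t => Φ.flow t z) 0 j s ≤ x ∧
      x ≤ s).card ≤ 2 := by
  have htraj := Φ.isTrajectory z hz
  set F' := F.filter fun s => flightStart (Torus.geometry (Fin 3)) (hsDiameter σ N) (fun t => Φ.flow t z) 0 j s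
    ≤ x ∧ x ≤ s with hF'
  rcases F'.eq_empty_or_nonempty with he | hne
  · simp [he]
  have hmemF' : ∀ {s : ℝ}, s ∈ F' → s ∈ F ∧
      flightStart (Torus.geometry (Fin 3)) (hsDiameter σ N) (fun t => Φ.flow t z) 0 j s ≤ x ∧ x ≤ s :=
    fun hs => Finset.mem_filter.1 hs
  set m := F'.min' hne with hm
  have hmF' : m ∈ F' := F'.min'_mem hne
  have hxm : x ≤ m := (hmemF' hmF').2.2
  -- no two distinct elements of `F'` other than `m`
  have hlt : ∀ a ∈ F'.erase m, ∀ b ∈ F'.erase m, a < b → False := by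
    intro a ha b hb hab
    obtain ⟨hane, haF'⟩ := Finset.mem_erase.1 ha
    obtain ⟨-, hbF'⟩ := Finset.mem_erase.1 hb
    have hma : m < a := lt_of_le_of_ne (F'.min'_le a haF') (Ne.symm hane)
    have haS := (hF a (hmemF' haF').1).1
    have ha0 : 0 < a := (hF a (hmemF' haF').1).2
    have hafs : a ≤ flightStart (Torus.geometry (Fin 3)) (hsDiameter σ N) (fun t => Φ.flow t z) 0 j b :=
      le_flightStart_of_mem (htraj.finite_collisionTimesOf_inter_Ioo j 0 b) haS ha0 hab
    have hbx := (hmemF' hbF').2.1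
    linarith
  have hsub : (F'.erase m).card ≤ 1 := by
    refine Finset.card_le_one.2 fun a ha b hb => ?_
    rcases lt_trichotomy a b with h | h | h
    · exact (hlt a ha b hb h).elim
    · exact h
    · exact (hlt b hb a ha h).elim
  have hcard : F'.card = (F'.erase m).card + 1 := (Finset.card_erase_add_one hmF').symm
  omega

/-! ## Enumeration and partner facts on the good set -/

/-- For `n < cnt_i` the `n`-th collision time of `i` is a collision time of `i` in `(0, τ]`. [folklore] -/
theorem nthCollisionTimeOf_mem_inter_of_lt_cnt (Φ : Flow σ N) (τ : ℝ) (z : Phase N) (i : Fin (N + 1)) {n : ℕ}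
    (hn : n < cnt Φ τ z i) :
    Φ.nthCollisionTimeOf i n z ∈
      collisionTimesOf (Torus.geometry (Fin 3)) (hsDiameter σ N) (fun t => Φ.flow t z) i ∩ Ioc 0 τ :=
  nthTimeAfter_mem_of_lt_ncard (S := collisionTimesOf (Torus.geometry (Fin 3)) (hsDiameter σ N)
    (fun s => Φ.flow s z) i) (a := 0) (b := τ) hn

/-- The enumeration of the collision times of `i` is injective below `cnt_i`. [folklore] -/
theorem nthCollisionTimeOf_injOn (Φ : Flow σ N) (τ : ℝ) (z : Phase N) (i : Fin (N + 1)) :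
    Set.InjOn (fun n => Φ.nthCollisionTimeOf i n z) {n | n < cnt Φ τ z i} :=
  (strictMonoOn_nthTimeAfter_of_ncard (S := collisionTimesOf (Torus.geometry (Fin 3)) (hsDiameter σ N)
    (fun s => Φ.flow s z) i) (a := 0) (b := τ)).injOn

/-- For `n < cnt_i`, sphere `i` collides with its `n`-th partner at its `n`-th collision time. [folklore] -/
theorem collide_nthPartnerOf_of_lt_cnt (Φ : Flow σ N) {τ : ℝ} {z : Phase N} {i : Fin (N + 1)} {n : ℕ}
    (hn : n < cnt Φ τ z i) :
    Collide (Torus.geometry (Fin 3)) (hsDiameter σ N) (Φ.flow (Φ.nthCollisionTimeOf i n z) z) i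
      (Φ.nthPartnerOf i n z) :=
  collide_partner (nthCollisionTimeOf_mem_inter_of_lt_cnt Φ τ z i hn).1

/-- For `n < cnt_i` the `n`-th collision time of `i` is a collision time of its partner. [folklore] -/
theorem nthCollisionTimeOf_mem_collisionTimesOf_nthPartnerOf (Φ : Flow σ N) {τ : ℝ} {z : Phase N}
    {i : Fin (N + 1)} {n : ℕ} (hn : n < cnt Φ τ z i) :
    Φ.nthCollisionTimeOf i n z ∈
      collisionTimesOf (Torus.geometry (Fin 3)) (hsDiameter σ N) (fun t => Φ.flow t z) (Φ.nthPartnerOf i n z) :=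
  ⟨i, (collide_nthPartnerOf_of_lt_cnt Φ hn).symm⟩

/-- **Binary collisions**: on a hard-sphere trajectory two spheres colliding with the same sphere at the same
time coincide. [folklore] -/
theorem eq_of_collide_of_collide (Φ : Flow σ N) {z : Phase N} (hz : z ∈ Φ.good) {t : ℝ}
    {i₁ i₂ j : Fin (N + 1)} (h₁ : Collide (Torus.geometry (Fin 3)) (hsDiameter σ N) (Φ.flow t z) i₁ j)
    (h₂ : Collide (Torus.geometry (Fin 3)) (hsDiameter σ N) (Φ.flow t z) i₂ j) : i₁ = i₂ := by
  have htraj := Φ.isTrajectory z hz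
  have hp₂ : Participates (Torus.geometry (Fin 3)) (hsDiameter σ N) (Φ.flow t z) i₂ := ⟨j, h₂⟩
  rcases h₁ with h | h
  · rcases (htraj.participates_iff (t := t) h).1 hp₂ with h' | h'
    · exact h'.symm
    · exact absurd h' h₂.ne
  · rcases (htraj.participates_iff (t := t) h).1 hp₂ with h' | h'
    · exact absurd h' h₂.ne
    · exact h'.symm


/-! ## The two window counts -/

/-- **Own flight.** For every instant `x` and sphere `i'`, at most two counted collisions `n' < cnt_{i'}` have
`flightStart_{i'}(t_{i',n'}) ≤ x ≤ t_{i',n'}`: the enumeration is injective into the finite set of collision times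
of `i'` in `(0, τ]` (`card_filter_flightStart_le_le_two`). [folklore] -/
theorem sum_range_cnt_ownFlight_le_two (Φ : Flow σ N) (τ : ℝ) {z : Phase N} (hz : z ∈ Φ.good)
    (i' : Fin (N + 1)) (x : ℝ) :
    ∑ n' ∈ Finset.range (cnt Φ τ z i'),
      (if flightStart (Torus.geometry (Fin 3)) (hsDiameter σ N) (fun s => Φ.flow s z) 0 i'
            (Φ.nthCollisionTimeOf i' n' z) ≤ x ∧ x ≤ Φ.nthCollisionTimeOf i' n' z then (1 : ℝ) else 0) ≤ 2 := by
  have hfin : (collisionTimesOf (Torus.geometry (Fin 3)) (hsDiameter σ N) (fun s => Φ.flow s z) i' ∩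
      Ioc 0 τ).Finite :=
    (Φ.finite_collisionTimes_inter hz (S := Ioc 0 τ) Ioc_subset_Icc_self).subset
      (inter_subset_inter_left _ (collisionTimesOf_subset _ i'))
  have hsum : ∑ n' ∈ Finset.range (cnt Φ τ z i'),
      (if flightStart (Torus.geometry (Fin 3)) (hsDiameter σ N) (fun s => Φ.flow s z) 0 i'
            (Φ.nthCollisionTimeOf i' n' z) ≤ x ∧ x ≤ Φ.nthCollisionTimeOf i' n' z then (1 : ℝ) else 0) =
      (((Finset.range (cnt Φ τ z i')).filter fun n' =>
        flightStart (Torus.geometry (Fin 3)) (hsDiameter σ N) (fun s => Φ.flow s z) 0 i'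
            (Φ.nthCollisionTimeOf i' n' z) ≤ x ∧ x ≤ Φ.nthCollisionTimeOf i' n' z).card : ℝ) := by
    rw [Finset.natCast_card_filter]
  rw [hsum]
  have hF2 := card_filter_flightStart_le_le_two Φ hz i' x hfin.toFinset (fun s hs =>
    have h := (Set.Finite.mem_toFinset hfin).1 hs
    ⟨h.1, h.2.1⟩)
  have hle : ((Finset.range (cnt Φ τ z i')).filter fun n' =>
        flightStart (Torus.geometry (Fin 3)) (hsDiameter σ N) (fun s => Φ.flow s z) 0 i'
            (Φ.nthCollisionTimeOf i' n' z) ≤ x ∧ x ≤ Φ.nthCollisionTimeOf i' n' z).card ≤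
      (hfin.toFinset.filter fun s =>
        flightStart (Torus.geometry (Fin 3)) (hsDiameter σ N) (fun t => Φ.flow t z) 0 i' s ≤ x ∧ x ≤ s).card := by
    refine Finset.card_le_card_of_injOn (fun n' => Φ.nthCollisionTimeOf i' n' z) (fun n' hn' => ?_) ?_
    · obtain ⟨hn', hPn'⟩ := Finset.mem_filter.1 (Finset.mem_coe.1 hn')
      exact Finset.mem_coe.2 (Finset.mem_filter.2 ⟨(Set.Finite.mem_toFinset hfin).2
        (nthCollisionTimeOf_mem_inter_of_lt_cnt Φ τ z i' (Finset.mem_range.1 hn')), hPn'⟩)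
    · exact (nthCollisionTimeOf_injOn Φ τ z i').mono fun n' hn' =>
        Finset.mem_range.1 (Finset.mem_filter.1 (Finset.mem_coe.1 hn')).1
  exact_mod_cast hle.trans hF2

/-- **Partner's flight.** For every instant `x`, at most `2 (N+1)` counted records `(i', n')`, `n' < cnt_{i'}`, have
`flightStart_{q'}(t_{i',n'}) ≤ x ≤ t_{i',n'}`, `q'` the partner of `i'` in that collision: the map
`(i', n') ↦ (q', t_{i',n'})` is injective (binary collisions, `eq_of_collide_of_collide`; injective enumeration)
into the pairs `(j, s)`, `s` a collision time of `j` in `(0, τ]` with `flightStart_j(s) ≤ x ≤ s` — at most two per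
`j` (`card_filter_flightStart_le_le_two`). [folklore] -/
theorem sum_cnt_partnerFlight_le (Φ : Flow σ N) (τ : ℝ) {z : Phase N} (hz : z ∈ Φ.good) (x : ℝ) :
    ∑ i' : Fin (N + 1), ∑ n' ∈ Finset.range (cnt Φ τ z i'),
      (if flightStart (Torus.geometry (Fin 3)) (hsDiameter σ N) (fun s => Φ.flow s z) 0 (Φ.nthPartnerOf i' n' z)
            (Φ.nthCollisionTimeOf i' n' z) ≤ x ∧ x ≤ Φ.nthCollisionTimeOf i' n' z then (1 : ℝ) else 0) ≤
      2 * ((N : ℝ) + 1) := by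
  have hfin : ∀ j : Fin (N + 1), (collisionTimesOf (Torus.geometry (Fin 3)) (hsDiameter σ N)
      (fun s => Φ.flow s z) j ∩ Ioc 0 τ).Finite := fun j =>
    (Φ.finite_collisionTimes_inter hz (S := Ioc 0 τ) Ioc_subset_Icc_self).subset
      (inter_subset_inter_left _ (collisionTimesOf_subset _ j))
  -- the records as one sigma finset, the count as a cardinality
  have hsum : ∑ i' : Fin (N + 1), ∑ n' ∈ Finset.range (cnt Φ τ z i'),
      (if flightStart (Torus.geometry (Fin 3)) (hsDiameter σ N) (fun s => Φ.flow s z) 0 (Φ.nthPartnerOf i' n' z)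
            (Φ.nthCollisionTimeOf i' n' z) ≤ x ∧ x ≤ Φ.nthCollisionTimeOf i' n' z then (1 : ℝ) else 0) =
      (((Finset.univ.sigma fun i : Fin (N + 1) => Finset.range (cnt Φ τ z i)).filter
        fun p : (Σ _ : Fin (N + 1), ℕ) =>
          flightStart (Torus.geometry (Fin 3)) (hsDiameter σ N) (fun s => Φ.flow s z) 0 (Φ.nthPartnerOf p.1 p.2 z)
            (Φ.nthCollisionTimeOf p.1 p.2 z) ≤ x ∧ x ≤ Φ.nthCollisionTimeOf p.1 p.2 z).card : ℝ) := by
    rw [Finset.natCast_card_filter, Finset.sum_sigma]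
  rw [hsum]
  -- the target: pairs `(j, s)`
  have h1 : ((Finset.univ.sigma fun i : Fin (N + 1) => Finset.range (cnt Φ τ z i)).filter
        fun p : (Σ _ : Fin (N + 1), ℕ) =>
          flightStart (Torus.geometry (Fin 3)) (hsDiameter σ N) (fun s => Φ.flow s z) 0 (Φ.nthPartnerOf p.1 p.2 z)
            (Φ.nthCollisionTimeOf p.1 p.2 z) ≤ x ∧ x ≤ Φ.nthCollisionTimeOf p.1 p.2 z).card ≤
      (Finset.univ.biUnion fun j : Fin (N + 1) => ((hfin j).toFinset.filter fun s =>
        flightStart (Torus.geometry (Fin 3)) (hsDiameter σ N) (fun t => Φ.flow t z) 0 j s ≤ x ∧ x ≤ s).image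
          fun s => (j, s)).card := by
    refine Finset.card_le_card_of_injOn (fun p => (Φ.nthPartnerOf p.1 p.2 z, Φ.nthCollisionTimeOf p.1 p.2 z))
      ?_ ?_
    · rintro ⟨i, n⟩ hp
      obtain ⟨hpR, hPp⟩ := Finset.mem_filter.1 (Finset.mem_coe.1 hp)
      have hn : n < cnt Φ τ z i := Finset.mem_range.1 (Finset.mem_sigma.1 hpR).2
      refine Finset.mem_coe.2 (Finset.mem_biUnion.2 ⟨Φ.nthPartnerOf i n z, Finset.mem_univ _,
        Finset.mem_image.2 ⟨Φ.nthCollisionTimeOf i n z, Finset.mem_filter.2 ⟨?_, hPp⟩, rfl⟩⟩)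
      exact (Set.Finite.mem_toFinset _).2 ⟨nthCollisionTimeOf_mem_collisionTimesOf_nthPartnerOf Φ hn,
        (nthCollisionTimeOf_mem_inter_of_lt_cnt Φ τ z i hn).2⟩
    · rintro ⟨i₁, n₁⟩ hp₁ ⟨i₂, n₂⟩ hp₂ heq
      obtain ⟨hp₁R, -⟩ := Finset.mem_filter.1 (Finset.mem_coe.1 hp₁)
      obtain ⟨hp₂R, -⟩ := Finset.mem_filter.1 (Finset.mem_coe.1 hp₂)
      have hn₁ : n₁ < cnt Φ τ z i₁ := Finset.mem_range.1 (Finset.mem_sigma.1 hp₁R).2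
      have hn₂ : n₂ < cnt Φ τ z i₂ := Finset.mem_range.1 (Finset.mem_sigma.1 hp₂R).2
      obtain ⟨hQ, hT⟩ := Prod.mk.inj heq
      have hc₁ := collide_nthPartnerOf_of_lt_cnt Φ hn₁
      have hc₂ := collide_nthPartnerOf_of_lt_cnt Φ hn₂
      rw [← hT, ← hQ] at hc₂
      have hi : i₁ = i₂ := eq_of_collide_of_collide Φ hz hc₁ hc₂
      subst hi
      have hn : n₁ = n₂ := nthCollisionTimeOf_injOn Φ τ z i₁ hn₁ hn₂ hT
      subst hn
      rfl
  have h2 : (Finset.univ.biUnion fun j : Fin (N + 1) => ((hfin j).toFinset.filter fun s =>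
        flightStart (Torus.geometry (Fin 3)) (hsDiameter σ N) (fun t => Φ.flow t z) 0 j s ≤ x ∧ x ≤ s).image
          fun s => (j, s)).card ≤ 2 * (N + 1) :=
    calc (Finset.univ.biUnion fun j : Fin (N + 1) => ((hfin j).toFinset.filter fun s =>
          flightStart (Torus.geometry (Fin 3)) (hsDiameter σ N) (fun t => Φ.flow t z) 0 j s ≤ x ∧ x ≤ s).image
            fun s => (j, s)).card
        ≤ ∑ j : Fin (N + 1), (((hfin j).toFinset.filter fun s =>
          flightStart (Torus.geometry (Fin 3)) (hsDiameter σ N) (fun t => Φ.flow t z) 0 j s ≤ x ∧ x ≤ s).image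
            fun s => (j, s)).card := Finset.card_biUnion_le
      _ ≤ ∑ _j : Fin (N + 1), 2 := Finset.sum_le_sum fun j _ => Finset.card_image_le.trans
          (card_filter_flightStart_le_le_two Φ hz j x (hfin j).toFinset fun s hs =>
            have h := (Set.Finite.mem_toFinset (hfin j)).1 hs
            ⟨h.1, h.2.1⟩)
      _ = 2 * (N + 1) := by simp [mul_comm]
  calc (((Finset.univ.sigma fun i : Fin (N + 1) => Finset.range (cnt Φ τ z i)).filter
        fun p : (Σ _ : Fin (N + 1), ℕ) =>
          flightStart (Torus.geometry (Fin 3)) (hsDiameter σ N) (fun s => Φ.flow s z) 0 (Φ.nthPartnerOf p.1 p.2 z)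
            (Φ.nthCollisionTimeOf p.1 p.2 z) ≤ x ∧ x ≤ Φ.nthCollisionTimeOf p.1 p.2 z).card : ℝ)
      ≤ ((2 * (N + 1) : ℕ) : ℝ) := by exact_mod_cast h1.trans h2
    _ = 2 * ((N : ℝ) + 1) := by push_cast; ring


/-! ## The pathwise bound on the number of unordered pairs -/

/-- On the good set the typed past carries the flight start of `i`, the flight start of the partner, and the
collision time. [folklore] -/
theorem past_snd_eq (Φ : Flow σ N) (r : ℝ) {z : Phase N} (hz : z ∈ Φ.good) (i : Fin (N + 1)) (n : ℕ) :
    (past Φ r z i n).2 =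
      (flightStart (Torus.geometry (Fin 3)) (hsDiameter σ N) (fun s => Φ.flow s z) 0 i (Φ.nthCollisionTimeOf i n z),
        flightStart (Torus.geometry (Fin 3)) (hsDiameter σ N) (fun s => Φ.flow s z) 0 (Φ.nthPartnerOf i n z)
          (Φ.nthCollisionTimeOf i n z),
        Φ.nthCollisionTimeOf i n z) := by
  simp [past, hz]

/-- **The pathwise count (law-independent, every mesh `r`).** On the good set the number of UNORDERED pairs of
counted kick records is at most `8 (N+1) Σ_i cnt_i`: if neither record precedes the other and `t ≤ t'`, then
`t` lies in the flight of `i'` or in the flight of its partner ending at `t'`; for a fixed record and a fixed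
sphere at most two own flights contain `t` (`sum_range_cnt_ownFlight_le_two`), and at most `2 (N+1)` records have a
partner flight containing `t` (`sum_cnt_partnerFlight_le`); the case `t' ≤ t` is symmetric (`Finset.sum_comm`).
[folklore] -/
theorem unorderedPairCount_le_of_mem_good (Φ : Flow σ N) (τ r : ℝ) {z : Phase N} (hz : z ∈ Φ.good) :
    ∑ i : Fin (N + 1), ∑ n ∈ Finset.range (cnt Φ τ z i),
      ∑ i' : Fin (N + 1), ∑ n' ∈ Finset.range (cnt Φ τ z i'),
        (if ¬ Precedes (past Φ r z i n) (past Φ r z i' n') ∧ ¬ Precedes (past Φ r z i' n') (past Φ r z i n)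
          then (1 : ℝ) else 0) ≤
      8 * ((N : ℝ) + 1) * ∑ i : Fin (N + 1), (cnt Φ τ z i : ℝ) := by
  -- the two window indicators, as functions of a pair of records
  set a : (Σ _ : Fin (N + 1), ℕ) → (Σ _ : Fin (N + 1), ℕ) → ℝ := fun p p' =>
    if flightStart (Torus.geometry (Fin 3)) (hsDiameter σ N) (fun s => Φ.flow s z) 0 p'.1
          (Φ.nthCollisionTimeOf p'.1 p'.2 z) ≤ Φ.nthCollisionTimeOf p.1 p.2 z ∧
        Φ.nthCollisionTimeOf p.1 p.2 z ≤ Φ.nthCollisionTimeOf p'.1 p'.2 z then (1 : ℝ) else 0 with ha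
  set b : (Σ _ : Fin (N + 1), ℕ) → (Σ _ : Fin (N + 1), ℕ) → ℝ := fun p p' =>
    if flightStart (Torus.geometry (Fin 3)) (hsDiameter σ N) (fun s => Φ.flow s z) 0 (Φ.nthPartnerOf p'.1 p'.2 z)
          (Φ.nthCollisionTimeOf p'.1 p'.2 z) ≤ Φ.nthCollisionTimeOf p.1 p.2 z ∧
        Φ.nthCollisionTimeOf p.1 p.2 z ≤ Φ.nthCollisionTimeOf p'.1 p'.2 z then (1 : ℝ) else 0 with hb
  have ha0 : ∀ p p', 0 ≤ a p p' := fun p p' => by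
    simp only [ha]
    split_ifs <;> norm_num
  have hb0 : ∀ p p', 0 ≤ b p p' := fun p p' => by
    simp only [hb]
    split_ifs <;> norm_num
  -- one record's collision time in the other's flight windows: the key order fact
  have hkey : ∀ p p' : (Σ _ : Fin (N + 1), ℕ),
      ¬ Precedes (past Φ r z p.1 p.2) (past Φ r z p'.1 p'.2) →
      Φ.nthCollisionTimeOf p.1 p.2 z ≤ Φ.nthCollisionTimeOf p'.1 p'.2 z → 1 ≤ a p p' + b p p' := by
    intro p p' h hle
    simp only [Precedes, past_snd_eq Φ r hz] at h
    by_cases h1 : flightStart (Torus.geometry (Fin 3)) (hsDiameter σ N) (fun s => Φ.flow s z) 0 p'.1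
        (Φ.nthCollisionTimeOf p'.1 p'.2 z) ≤ Φ.nthCollisionTimeOf p.1 p.2 z
    · have : a p p' = 1 := by
        simp only [ha]
        rw [if_pos ⟨h1, hle⟩]
      linarith [hb0 p p']
    · have h2 : flightStart (Torus.geometry (Fin 3)) (hsDiameter σ N) (fun s => Φ.flow s z) 0
          (Φ.nthPartnerOf p'.1 p'.2 z) (Φ.nthCollisionTimeOf p'.1 p'.2 z) ≤ Φ.nthCollisionTimeOf p.1 p.2 z := by
        by_contra h2
        exact h ⟨lt_of_not_ge h1, lt_of_not_ge h2⟩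
      have : b p p' = 1 := by
        simp only [hb]
        rw [if_pos ⟨h2, hle⟩]
      linarith [ha0 p p']
  -- pointwise: an unordered pair lands in one of the four windows
  have hpt : ∀ p p' : (Σ _ : Fin (N + 1), ℕ),
      (if ¬ Precedes (past Φ r z p.1 p.2) (past Φ r z p'.1 p'.2) ∧
          ¬ Precedes (past Φ r z p'.1 p'.2) (past Φ r z p.1 p.2) then (1 : ℝ) else 0) ≤
        a p p' + b p p' + (a p' p + b p' p) := by
    intro p p'
    by_cases h : ¬ Precedes (past Φ r z p.1 p.2) (past Φ r z p'.1 p'.2) ∧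
        ¬ Precedes (past Φ r z p'.1 p'.2) (past Φ r z p.1 p.2)
    · rw [if_pos h]
      rcases le_total (Φ.nthCollisionTimeOf p.1 p.2 z) (Φ.nthCollisionTimeOf p'.1 p'.2 z) with hle | hle
      · linarith [hkey p p' h.1 hle, ha0 p' p, hb0 p' p]
      · linarith [hkey p' p h.2 hle, ha0 p p', hb0 p p']
    · rw [if_neg h]
      linarith [ha0 p p', hb0 p p', ha0 p' p, hb0 p' p]
  -- the records as one sigma finset
  set R : Finset (Σ _ : Fin (N + 1), ℕ) := Finset.univ.sigma fun i : Fin (N + 1) => Finset.range (cnt Φ τ z i)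
    with hR
  have hcardR : (R.card : ℝ) = ∑ i : Fin (N + 1), (cnt Φ τ z i : ℝ) := by
    rw [hR, Finset.card_sigma]
    push_cast
    simp [Finset.card_range]
  -- inner bounds: own flights and partner flights
  have hA : ∀ p ∈ R, ∑ p' ∈ R, a p p' ≤ 2 * ((N : ℝ) + 1) := fun p _ => by
    rw [hR, Finset.sum_sigma]
    calc ∑ i' : Fin (N + 1), ∑ n' ∈ Finset.range (cnt Φ τ z i'), a p ⟨i', n'⟩
        ≤ ∑ _i' : Fin (N + 1), (2 : ℝ) := Finset.sum_le_sum fun i' _ => by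
          simp only [ha]
          exact sum_range_cnt_ownFlight_le_two Φ τ hz i' _
      _ = 2 * ((N : ℝ) + 1) := by simp [mul_comm]
  have hB : ∀ p ∈ R, ∑ p' ∈ R, b p p' ≤ 2 * ((N : ℝ) + 1) := fun p _ => by
    rw [hR, Finset.sum_sigma]
    simp only [hb]
    exact sum_cnt_partnerFlight_le Φ τ hz _
  -- assemble
  calc ∑ i : Fin (N + 1), ∑ n ∈ Finset.range (cnt Φ τ z i),
        ∑ i' : Fin (N + 1), ∑ n' ∈ Finset.range (cnt Φ τ z i'),
          (if ¬ Precedes (past Φ r z i n) (past Φ r z i' n') ∧ ¬ Precedes (past Φ r z i' n') (past Φ r z i n)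
            then (1 : ℝ) else 0)
      = ∑ p ∈ R, ∑ p' ∈ R, (if ¬ Precedes (past Φ r z p.1 p.2) (past Φ r z p'.1 p'.2) ∧
          ¬ Precedes (past Φ r z p'.1 p'.2) (past Φ r z p.1 p.2) then (1 : ℝ) else 0) := by
        simp only [hR, Finset.sum_sigma]
    _ ≤ ∑ p ∈ R, ∑ p' ∈ R, (a p p' + b p p' + (a p' p + b p' p)) :=
        Finset.sum_le_sum fun p _ => Finset.sum_le_sum fun p' _ => hpt p p'
    _ = 2 * ∑ p ∈ R, ∑ p' ∈ R, a p p' + 2 * ∑ p ∈ R, ∑ p' ∈ R, b p p' := by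
        have hca : ∑ p ∈ R, ∑ p' ∈ R, a p' p = ∑ p ∈ R, ∑ p' ∈ R, a p p' := Finset.sum_comm
        have hcb : ∑ p ∈ R, ∑ p' ∈ R, b p' p = ∑ p ∈ R, ∑ p' ∈ R, b p p' := Finset.sum_comm
        simp only [Finset.sum_add_distrib]
        rw [hca, hcb]
        ring
    _ ≤ 2 * ∑ _p ∈ R, (2 * ((N : ℝ) + 1)) + 2 * ∑ _p ∈ R, (2 * ((N : ℝ) + 1)) :=
        add_le_add (mul_le_mul_of_nonneg_left (Finset.sum_le_sum hA) (by norm_num))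
          (mul_le_mul_of_nonneg_left (Finset.sum_le_sum hB) (by norm_num))
    _ = 8 * ((N : ℝ) + 1) * ∑ i : Fin (N + 1), (cnt Φ τ z i : ℝ) := by
        rw [Finset.sum_const, nsmul_eq_mul, hcardR]
        ring

/-- **The pathwise count, all binders after the colon** (the form to register as a sub-goal): on the good set of
every hard-sphere flow, for every horizon `τ` and mesh `r`, the number of unordered pairs of counted kick records is
at most `8 (N+1) Σ_i cnt_i` (`unorderedPairCount_le_of_mem_good`). [folklore] -/
theorem unorderedPairCount_le : ∀ (σ : ℝ) (N : ℕ) (Φ : Flow σ N) (τ r : ℝ) (z : Phase N), z ∈ Φ.good → ∑ i : Fin (N + 1), ∑ n ∈ Finset.range (cnt Φ τ z i), ∑ i' : Fin (N + 1), ∑ n' ∈ Finset.range (cnt Φ τ z i'), (if ¬ Precedes (past Φ r z i n) (past Φ r z i' n') ∧ ¬ Precedes (past Φ r z i' n') (past Φ r z i n) then (1 : ℝ) else 0) ≤ 8 * ((N : ℝ) + 1) * ∑ i : Fin (N + 1), (cnt Φ τ z i : ℝ) :=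
  fun _ _ Φ τ r _ hz => unorderedPairCount_le_of_mem_good Φ τ r hz

end Summit.AtomisticToContinuum.HydrodynamicLimit.Theorems.KickFairRelEquilibriumMesoLine

end
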